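import Summits.QuantumAdvantage.QuantumAdvantage.Theorems.WalkThreeStepRigidLoss

/-!
# Rung (G♯₂) `ThreeStepFreeRungFive` (item stmt-QuantumAdvantage-23286), architecture (U): FIBRE SUMMATION over an interval and
# INTERVAL SELECTION (assembly groundwork, generic)

Cell qa-qnc0, route OddPrimeWalk, support item stmt-QuantumAdvantage-23286; prover qn-prover-3 g16.  Two hypothesis-free counting lemmas the
assembly (module U-f) needs:
* §1 FIBRES: every input is `place o a L P` for a unique outside representative `o` (zero on `[a, a+L)`) and pattern `P ∈ {0,1}^L`
  (`place_clear_restrict`, `clear_place`, `restrict_place`); hence `card_filter_eq_sum_fibre`: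
  `#{u : f u} = Σ_{o} #{P : f (place o a L P)}`, `sum_fibre_pow : Σ_o 2^L = 2^n`, and **`card_le_of_fibre_le`**: if every fibre has at
  most `θ·2^L` good patterns then `#{u : f u} ≤ θ·2^n` — this turns `rigid_loss`/`rigid_loss_far` (per-fibre bounds) into a global bound.
* §2 INTERVAL SELECTION: **`exists_clean_interval`** — if `B` is a finite set of "bad" positions and `(B.card + 1)·L ≤ N`, there is a block
  `[j·L, j·L + L)` below `N` free of `B` (pigeonhole over disjoint blocks); the assembly uses it with `B` = hubs ∪ reads of the end-positioned cuts.
WHAT THIS IS NOT: no game content beyond `place`; separation NOT moved.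
-/

namespace Summit.QuantumAdvantage.AdviceFreeQNC0.LocalEngine

open Finset Classical

namespace RungU

variable {n : ℕ}

/-! ### §1 Fibres over an interval -/

/-- clear the bits of `[a, a+L)`. -/
def clear (a L : ℕ) (u : Fin n → Bool) : Fin n → Bool :=
  fun i => if a ≤ i.val ∧ i.val < a + L then false else u i

/-- read the bits of `[a, a+L)` as a pattern (`a + L ≤ n`). -/
def restrict (a L : ℕ) (h : a + L ≤ n) (u : Fin n → Bool) : Fin L → Bool :=
  fun j => u ⟨a + j.val, by omega⟩

/-- `u` is zero on `[a, a+L)`. -/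
def ZeroOn (a L : ℕ) (u : Fin n → Bool) : Prop := ∀ i : Fin n, a ≤ i.val → i.val < a + L → u i = false

/-- a cleared input is zero on the interval. -/
theorem zeroOn_clear (a L : ℕ) (u : Fin n → Bool) : ZeroOn a L (clear a L u) := by
  intro i h1 h2; unfold clear; rw [if_pos ⟨h1, h2⟩]

/-- reassembling an input from its outside part and its pattern. -/
theorem place_clear_restrict (a L : ℕ) (h : a + L ≤ n) (u : Fin n → Bool) :
    place (clear a L u) a L (restrict a L h u) = u := by
  funext i
  unfold place clear restrict
  by_cases hi : a ≤ i.val ∧ i.val < a + L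
  · rw [dif_pos hi]
    congr 1
    apply Fin.ext; simp; omega
  · rw [dif_neg hi, if_neg hi]

/-- the outside part of a placed pattern. -/
theorem clear_place (a L : ℕ) {o : Fin n → Bool} (ho : ZeroOn a L o) (P : Fin L → Bool) : clear a L (place o a L P) = o := by
  funext i
  unfold clear place
  by_cases hi : a ≤ i.val ∧ i.val < a + L
  · rw [if_pos hi, ho i hi.1 hi.2]
  · rw [if_neg hi, dif_neg hi]

/-- the pattern of a placed pattern. -/
theorem restrict_place (a L : ℕ) (h : a + L ≤ n) (o : Fin n → Bool) (P : Fin L → Bool) : restrict a L h (place o a L P) = P := by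
  funext j
  unfold restrict place
  rw [dif_pos (by show a ≤ a + j.val ∧ a + j.val < a + L; omega)]
  congr 1
  apply Fin.ext; simp

/-- the outside representatives. -/
noncomputable def outsides (n a L : ℕ) : Finset (Fin n → Bool) := univ.filter fun o => ZeroOn a L o

/-- **fibre summation**: `#{u : f u} = Σ_{o} #{P : f (place o a L P)}`. -/
theorem card_filter_eq_sum_fibre (a L : ℕ) (h : a + L ≤ n) (f : (Fin n → Bool) → Bool) :
    ((univ : Finset (Fin n → Bool)).filter fun u => f u = true).card
      = ∑ o ∈ outsides n a L, ((univ : Finset (Fin L → Bool)).filter fun P => f (place o a L P) = true).card := by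
  rw [Finset.card_eq_sum_card_fiberwise (f := clear a L) (t := outsides n a L)
    (fun u _ => Finset.mem_coe.mpr (by unfold outsides; rw [Finset.mem_filter]; exact ⟨mem_univ _, zeroOn_clear a L u⟩))]
  apply Finset.sum_congr rfl
  intro o ho
  unfold outsides at ho
  rw [Finset.mem_filter] at ho
  apply Finset.card_bij (fun u _ => restrict a L h u)
  · intro u hu
    simp only [Finset.mem_filter, Finset.mem_univ, true_and] at hu ⊢
    have e := place_clear_restrict a L h u
    rw [hu.2] at e
    rw [e]; exact hu.1
  · intro u hu u' hu' heq
    simp only [Finset.mem_filter, Finset.mem_univ, true_and] at hu hu'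
    rw [← place_clear_restrict a L h u, ← place_clear_restrict a L h u', hu.2, hu'.2, heq]
  · intro P hP
    simp only [Finset.mem_filter, Finset.mem_univ, true_and] at hP
    refine ⟨place o a L P, ?_, restrict_place a L h o P⟩
    simp only [Finset.mem_filter, Finset.mem_univ, true_and]
    exact ⟨hP, clear_place a L ho.2 P⟩

/-- the fibres partition the cube: `Σ_o 2^L = 2^n`. -/
theorem sum_fibre_pow (a L : ℕ) (h : a + L ≤ n) : ∑ _o ∈ outsides n a L, 2 ^ L = 2 ^ n := by
  have e := card_filter_eq_sum_fibre a L h (fun _ => true)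
  rw [Finset.filter_true_of_mem (fun _ _ => rfl), Finset.card_univ, Fintype.card_fun, Fintype.card_bool, Fintype.card_fin] at e
  rw [e]
  apply Finset.sum_congr rfl
  intro o _
  rw [Finset.filter_true_of_mem (fun _ _ => rfl), Finset.card_univ, Fintype.card_fun, Fintype.card_bool, Fintype.card_fin]

/-- **from fibres to the cube**: a uniform per-fibre bound gives a global bound. -/
theorem card_le_of_fibre_le (a L : ℕ) (h : a + L ≤ n) (f : (Fin n → Bool) → Bool) (θ : ℝ)
    (hf : ∀ o ∈ outsides n a L, ((((univ : Finset (Fin L → Bool)).filter fun P => f (place o a L P) = true).card : ℕ) : ℝ)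
      ≤ θ * (2 : ℝ) ^ L) :
    ((((univ : Finset (Fin n → Bool)).filter fun u => f u = true).card : ℕ) : ℝ) ≤ θ * (2 : ℝ) ^ n := by
  rw [card_filter_eq_sum_fibre a L h f]
  push_cast
  have hs := sum_fibre_pow (n := n) a L h
  calc ∑ o ∈ outsides n a L, ((((univ : Finset (Fin L → Bool)).filter fun P => f (place o a L P) = true).card : ℕ) : ℝ)
      ≤ ∑ _o ∈ outsides n a L, θ * (2 : ℝ) ^ L := Finset.sum_le_sum hf
    _ = θ * (∑ _o ∈ outsides n a L, (2 : ℝ) ^ L) := by rw [Finset.mul_sum]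
    _ = θ * (2 : ℝ) ^ n := by
        congr 1
        have : (∑ _o ∈ outsides n a L, (2 : ℝ) ^ L) = ((∑ _o ∈ outsides n a L, 2 ^ L : ℕ) : ℝ) := by push_cast; rfl
        rw [this, hs]; push_cast; rfl

/-! ### §2 Interval selection -/

/-- **a clean block among `#B + 1` disjoint blocks**: if `(B.card + 1) * L ≤ N` then some block `[j L, j L + L)` with `j L + L ≤ N`
contains no element of `B`. -/
theorem exists_clean_interval (B : Finset ℕ) (L N : ℕ) (hN : (B.card + 1) * L ≤ N) :
    ∃ j : ℕ, j * L + L ≤ N ∧ ∀ b ∈ B, ¬ (j * L ≤ b ∧ b < j * L + L) := by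
  set bad : Finset ℕ := (range (B.card + 1)).filter fun j => ∃ b ∈ B, j * L ≤ b ∧ b < j * L + L with hbad
  have hle : bad.card ≤ B.card := by
    let w : ℕ → ℕ := fun j => if h : ∃ b ∈ B, j * L ≤ b ∧ b < j * L + L then Classical.choose h else 0
    have hw : ∀ j ∈ bad, w j ∈ B ∧ j * L ≤ w j ∧ w j < j * L + L := by
      intro j hj
      rw [hbad, Finset.mem_filter] at hj
      have hs := Classical.choose_spec hj.2
      simp only [w, dif_pos hj.2]
      exact ⟨hs.1, hs.2⟩
    apply Finset.card_le_card_of_injOn w (fun j hj => (hw j hj).1)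
    intro j hj j' hj' he
    have a1 := hw j hj
    have a2 := hw j' hj'
    rw [he] at a1
    have b1 : j * L < (j' + 1) * L := by nlinarith
    have b2 : j' * L < (j + 1) * L := by nlinarith
    have c1 := Nat.lt_of_mul_lt_mul_right b1
    have c2 := Nat.lt_of_mul_lt_mul_right b2
    omega
  have hsplit := Finset.card_filter_add_card_filter_not (s := range (B.card + 1))
    (fun j => ∃ b ∈ B, j * L ≤ b ∧ b < j * L + L)
  rw [Finset.card_range] at hsplit
  have hpos : 0 < ((range (B.card + 1)).filter fun j => ¬ ∃ b ∈ B, j * L ≤ b ∧ b < j * L + L).card := by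
    rw [hbad] at hle; omega
  obtain ⟨j, hj⟩ := Finset.card_pos.mp hpos
  rw [Finset.mem_filter, Finset.mem_range] at hj
  refine ⟨j, ?_, fun b hb hh => hj.2 ⟨b, hb, hh⟩⟩
  have : (j + 1) * L ≤ (B.card + 1) * L := Nat.mul_le_mul_right L hj.1
  nlinarith

end RungU

end Summit.QuantumAdvantage.AdviceFreeQNC0.LocalEngine
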